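import Literature.MathematicalPhysics.QuantumLattice.WilsonDiracSpinBasis
import Literature.MathematicalPhysics.QuantumLattice.WilsonDiracAP
import Literature.LinearAlgebra.Matrix.WilsonBlockDeterminant
import HarnessLib

/-!
# Time slices of the Wilson–Dirac operator

The `r = 1` Wilson–Dirac operator `D = (m+4) - ½ Σ_μ [(1-γ_μ) U_μ T_μ + (1+γ_μ) U_μ⁻¹ T_μ⁻¹]` on the
torus `(ℤ/(n+1))⁴`, written in the Dirac-type spin basis `γ'₀ = diag(1,1,-1,-1)` of
`WilsonDiracSpinBasis` and re-indexed by (upper/lower spinor half, (spatial site, colour,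
half-spin), time) via `timeIndex`. We define the slice blocks of the standard transfer-matrix
decomposition for Wilson fermions — the spatial diagonal block `a_t = d_t` (`sliceDiag`), the
spatial off-diagonal block `b_t` (`sliceOff`) and the temporal link block `w_t` (`sliceLink`) —
and compute their entries (Lüscher, Comm. Math. Phys. 54 (1977) 283, §3; Montvay–Münster,
*Quantum Fields on a Lattice* (1994), §4.2.3).
-/

noncomputable section

-- The time-slice index types (`((κ × Fin 2) ⊕ (κ × Fin 2)) × Fin (n+1)` and the Gram indices built
-- from them) are too deep for the default instance-search size bound (`DecidableEq`, needed by
-- `Matrix.det`).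
set_option synthInstance.maxSize 512

namespace Literature.MathematicalPhysics.QuantumLattice

section TimeSlices

open _root_.Matrix Literature.Probability.LatticeModels QuantumFieldTheory Literature.LinearAlgebra.Matrix
open scoped Kronecker ComplexOrder

variable {n N : ℕ} {G : Type*} [Group G] (ρ : G →* Matrix (Fin N) (Fin N) ℂ)

/-- The site of the torus `(ℤ/(n+1))⁴` with time coordinate `t : Fin (n+1)` and spatial
coordinates `y`. [folklore] -/
def sliceSite (t : Fin (n + 1)) (y : Fin 3 → ZMod (n + 1)) : TorusSite 4 (n + 1) :=
  Fin.cons (ZMod.finEquiv (n + 1) t) y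

omit [Group G] in
/-- Two slice sites agree iff their time and space coordinates agree. [folklore] -/
@[simp] theorem sliceSite_inj {t s : Fin (n + 1)} {y y' : Fin 3 → ZMod (n + 1)} :
    sliceSite t y = sliceSite s y' ↔ t = s ∧ y = y' := by
  rw [sliceSite, sliceSite, Fin.cons_inj, (ZMod.finEquiv (n + 1)).injective.eq_iff]

/-- The temporal shift of a slice site. [folklore] -/
theorem sliceSite_shift_zero (t : Fin (n + 1)) (y : Fin 3 → ZMod (n + 1)) :
    QuantumFieldTheory.Site.shift (sliceSite t y) 0 = sliceSite (t + 1) y := by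
  ext i
  refine Fin.cases ?_ (fun i => ?_) i
  · simp [sliceSite, QuantumFieldTheory.Site.shift]
  · simp [sliceSite, QuantumFieldTheory.Site.shift, Fin.cons_succ, Fin.succ_ne_zero]

/-- A spatial shift of a slice site. [folklore] -/
theorem sliceSite_shift_succ (t : Fin (n + 1)) (y : Fin 3 → ZMod (n + 1)) (j : Fin 3) :
    QuantumFieldTheory.Site.shift (sliceSite t y) j.succ = sliceSite t (y + Pi.single j 1) := by
  ext i
  refine Fin.cases ?_ (fun i => ?_) i
  · simp [sliceSite, QuantumFieldTheory.Site.shift]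
  · simp [sliceSite, QuantumFieldTheory.Site.shift, Fin.cons_succ, Pi.single_apply, Fin.succ_inj]

/-- `sliceSite s y' = sliceSite t y + ê₀ ↔ s = t + 1 ∧ y' = y`. [folklore] -/
@[simp] theorem sliceSite_eq_shift_zero_iff {t s : Fin (n + 1)} {y y' : Fin 3 → ZMod (n + 1)} :
    sliceSite s y' = QuantumFieldTheory.Site.shift (sliceSite t y) 0 ↔ s = t + 1 ∧ y' = y := by
  rw [sliceSite_shift_zero, sliceSite_inj]

/-- `sliceSite s y' = sliceSite t y + ê_{j+1} ↔ s = t ∧ y' = y + ê_j`. [folklore] -/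
@[simp] theorem sliceSite_eq_shift_succ_iff {t s : Fin (n + 1)} {y y' : Fin 3 → ZMod (n + 1)}
    {j : Fin 3} :
    sliceSite s y' = QuantumFieldTheory.Site.shift (sliceSite t y) j.succ ↔ s = t ∧ y' = y + Pi.single j 1 := by
  rw [sliceSite_shift_succ, sliceSite_inj]

/-- **The time-slice indexing**: (upper/lower spinor component, (spatial site, colour, half
spin), time) `↦` (site, colour, spin) with spins `0, 1` upper and `2, 3` lower. [folklore] -/
def timeIndex (n N : ℕ) :
    ((((Fin 3 → ZMod (n + 1)) × Fin N) × Fin 2) ⊕ (((Fin 3 → ZMod (n + 1)) × Fin N) × Fin 2)) ×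
        Fin (n + 1) ≃ (TorusSite 4 (n + 1) × Fin N) × Fin 4 where
  toFun p := Sum.elim (fun u => ((sliceSite p.2 u.1.1, u.1.2), Fin.castAdd 2 u.2))
    (fun u => ((sliceSite p.2 u.1.1, u.1.2), Fin.natAdd 2 u.2)) p.1
  invFun q := (Sum.map (fun h => ((Fin.tail q.1.1, q.1.2), h)) (fun h => ((Fin.tail q.1.1, q.1.2), h))
      (finSumFinEquiv.symm q.2), (ZMod.finEquiv (n + 1)).symm (q.1.1 0))
  left_inv := by
    rintro ⟨u | u, t⟩
    · simp only [Sum.elim_inl, finSumFinEquiv_symm_apply_castAdd, Sum.map_inl]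
      simp [sliceSite]
    · simp only [Sum.elim_inr, finSumFinEquiv_symm_apply_natAdd, Sum.map_inr]
      simp [sliceSite]
  right_inv := by
    rintro ⟨⟨x, a⟩, α⟩
    obtain ⟨w, rfl⟩ := (finSumFinEquiv (m := 2) (n := 2)).surjective α
    rcases w with h | h
    · simp only [finSumFinEquiv_apply_left, finSumFinEquiv_symm_apply_castAdd, Sum.map_inl, Sum.elim_inl]
      simp [sliceSite, Fin.cons_self_tail]
    · simp only [finSumFinEquiv_apply_right, finSumFinEquiv_symm_apply_natAdd, Sum.map_inr, Sum.elim_inr]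
      simp [sliceSite, Fin.cons_self_tail]

omit [Group G] in
/-- `timeIndex` on upper components. [folklore] -/
@[simp] theorem timeIndex_inl (u : ((Fin 3 → ZMod (n + 1)) × Fin N) × Fin 2) (t : Fin (n + 1)) :
    timeIndex n N (Sum.inl u, t) = ((sliceSite t u.1.1, u.1.2), Fin.castAdd 2 u.2) := rfl

omit [Group G] in
/-- `timeIndex` on lower components. [folklore] -/
@[simp] theorem timeIndex_inr (u : ((Fin 3 → ZMod (n + 1)) × Fin N) × Fin 2) (t : Fin (n + 1)) :
    timeIndex n N (Sum.inr u, t) = ((sliceSite t u.1.1, u.1.2), Fin.natAdd 2 u.2) := rfl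

/-! ### Entries of the Dirac-type spin matrices on upper/lower components -/

/-- Upper–upper entries of `1 ∓ γ'₀`, `1 ∓ γ'_{j+1}`. [folklore] -/
theorem diracGamma_uu (h h' : Fin 2) :
    (1 - diracGamma 0) (Fin.castAdd 2 h) (Fin.castAdd 2 h') = 0 ∧
    (1 + diracGamma 0) (Fin.castAdd 2 h) (Fin.castAdd 2 h') = (if h = h' then 2 else 0) ∧
    (∀ j : Fin 3, (1 - diracGamma j.succ) (Fin.castAdd 2 h) (Fin.castAdd 2 h') = if h = h' then 1 else 0) ∧
    (∀ j : Fin 3, (1 + diracGamma j.succ) (Fin.castAdd 2 h) (Fin.castAdd 2 h') = if h = h' then 1 else 0) := by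
  refine ⟨?_, ?_, fun j => ?_, fun j => ?_⟩ <;> (try fin_cases j) <;> fin_cases h <;> fin_cases h' <;>
    simp [diracGamma, Matrix.sub_apply, Matrix.add_apply] <;> norm_num

/-- Upper–lower entries. [folklore] -/
theorem diracGamma_ul (h h' : Fin 2) :
    (1 - diracGamma 0) (Fin.castAdd 2 h) (Fin.natAdd 2 h') = 0 ∧
    (1 + diracGamma 0) (Fin.castAdd 2 h) (Fin.natAdd 2 h') = 0 ∧
    (∀ j : Fin 3, (1 - diracGamma j.succ) (Fin.castAdd 2 h) (Fin.natAdd 2 h') = -diracBlock j h h') ∧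
    (∀ j : Fin 3, (1 + diracGamma j.succ) (Fin.castAdd 2 h) (Fin.natAdd 2 h') = diracBlock j h h') := by
  refine ⟨?_, ?_, fun j => ?_, fun j => ?_⟩ <;> (try fin_cases j) <;> fin_cases h <;> fin_cases h' <;>
    simp [diracGamma, diracBlock, Matrix.sub_apply, Matrix.add_apply]

/-- Lower–upper entries. [folklore] -/
theorem diracGamma_lu (h h' : Fin 2) :
    (1 - diracGamma 0) (Fin.natAdd 2 h) (Fin.castAdd 2 h') = 0 ∧
    (1 + diracGamma 0) (Fin.natAdd 2 h) (Fin.castAdd 2 h') = 0 ∧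
    (∀ j : Fin 3, (1 - diracGamma j.succ) (Fin.natAdd 2 h) (Fin.castAdd 2 h') = -(diracBlock j)ᴴ h h') ∧
    (∀ j : Fin 3, (1 + diracGamma j.succ) (Fin.natAdd 2 h) (Fin.castAdd 2 h') = (diracBlock j)ᴴ h h') := by
  refine ⟨?_, ?_, fun j => ?_, fun j => ?_⟩ <;> (try fin_cases j) <;> fin_cases h <;> fin_cases h' <;>
    simp [diracGamma, diracBlock, Matrix.sub_apply, Matrix.add_apply, Matrix.conjTranspose_apply]

/-- Lower–lower entries. [folklore] -/
theorem diracGamma_ll (h h' : Fin 2) :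
    (1 - diracGamma 0) (Fin.natAdd 2 h) (Fin.natAdd 2 h') = (if h = h' then 2 else 0) ∧
    (1 + diracGamma 0) (Fin.natAdd 2 h) (Fin.natAdd 2 h') = 0 ∧
    (∀ j : Fin 3, (1 - diracGamma j.succ) (Fin.natAdd 2 h) (Fin.natAdd 2 h') = if h = h' then 1 else 0) ∧
    (∀ j : Fin 3, (1 + diracGamma j.succ) (Fin.natAdd 2 h) (Fin.natAdd 2 h') = if h = h' then 1 else 0) := by
  refine ⟨?_, ?_, fun j => ?_, fun j => ?_⟩ <;> (try fin_cases j) <;> fin_cases h <;> fin_cases h' <;>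
    simp [diracGamma, Matrix.sub_apply, Matrix.add_apply] <;> norm_num

/-! ### The slice blocks -/

/-- Forward spatial hopping within the time slice `t`, direction `j + 1`:
`(y, a), (y', b) ↦ [y' = y + ê_j] ρ(U((t, y), j+1))_{ab}`. [folklore] -/
def sliceHop (U : GaugeConfig 4 (n + 1) G) (t : Fin (n + 1)) (j : Fin 3) :
    Matrix ((Fin 3 → ZMod (n + 1)) × Fin N) ((Fin 3 → ZMod (n + 1)) × Fin N) ℂ :=
  Matrix.of fun p q => if q.1 = p.1 + Pi.single j 1 then ρ (U (sliceSite t p.1, j.succ)) p.2 q.2 else 0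

/-- Backward spatial hopping within the time slice `t`, direction `j + 1`. [folklore] -/
def sliceHop' (U : GaugeConfig 4 (n + 1) G) (t : Fin (n + 1)) (j : Fin 3) :
    Matrix ((Fin 3 → ZMod (n + 1)) × Fin N) ((Fin 3 → ZMod (n + 1)) × Fin N) ℂ :=
  Matrix.of fun p q => if p.1 = q.1 + Pi.single j 1 then ρ (U (sliceSite t q.1, j.succ))⁻¹ p.2 q.2 else 0

/-- **The spatial (diagonal) block** `a_t = d_t = (m + 4) - ½ Σ_j (H_j + H'_j) ⊗ 1₂` of the slice
`t` (the `r`-part of the spatial Wilson operator; it is the same on upper and lower components). [folklore] -/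
def sliceDiag (U : GaugeConfig 4 (n + 1) G) (m : ℝ) (t : Fin (n + 1)) :
    Matrix (((Fin 3 → ZMod (n + 1)) × Fin N) × Fin 2) (((Fin 3 → ZMod (n + 1)) × Fin N) × Fin 2) ℂ :=
  ((m + 4 : ℝ) : ℂ) • (1 : Matrix _ _ ℂ) -
    (1 / 2 : ℂ) • ∑ j : Fin 3, ((sliceHop ρ U t j + sliceHop' ρ U t j) ⊗ₖ (1 : Matrix (Fin 2) (Fin 2) ℂ))

/-- **The spatial off-diagonal block** `b_t = ½ Σ_j (H_j - H'_j) ⊗ g_j` of the slice `t` (the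
`γ`-part of the spatial Wilson operator between upper and lower components). [folklore] -/
def sliceOff (U : GaugeConfig 4 (n + 1) G) (t : Fin (n + 1)) :
    Matrix (((Fin 3 → ZMod (n + 1)) × Fin N) × Fin 2) (((Fin 3 → ZMod (n + 1)) × Fin N) × Fin 2) ℂ :=
  (1 / 2 : ℂ) • ∑ j : Fin 3, ((sliceHop ρ U t j - sliceHop' ρ U t j) ⊗ₖ diracBlock j)

/-- The temporal link variables of the layer `t → t + 1` as a block-diagonal matrix on
spatial site × colour. [folklore] -/
def timeLink (U : GaugeConfig 4 (n + 1) G) (t : Fin (n + 1)) :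
    Matrix ((Fin 3 → ZMod (n + 1)) × Fin N) ((Fin 3 → ZMod (n + 1)) × Fin N) ℂ :=
  Matrix.of fun p q => if p.1 = q.1 then ρ (U (sliceSite t p.1, 0)) p.2 q.2 else 0

/-- **The temporal block** `w_t = (link variables of layer t) ⊗ 1₂`. [folklore] -/
def sliceLink (U : GaugeConfig 4 (n + 1) G) (t : Fin (n + 1)) :
    Matrix (((Fin 3 → ZMod (n + 1)) × Fin N) × Fin 2) (((Fin 3 → ZMod (n + 1)) × Fin N) × Fin 2) ℂ :=
  timeLink ρ U t ⊗ₖ (1 : Matrix (Fin 2) (Fin 2) ℂ)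

/-! ### Entries of the slice blocks -/

omit [Group G] in
/-- Entries of `X ⊗ 1₂`. [folklore] -/
private theorem kron_one_two_apply {κ : Type*} (X : Matrix κ κ ℂ) (p q : κ) (h h' : Fin 2) :
    (X ⊗ₖ (1 : Matrix (Fin 2) (Fin 2) ℂ)) (p, h) (q, h') = X p q * (if h = h' then 1 else 0) := by
  rw [Matrix.kroneckerMap_apply, Matrix.one_apply]

/-- Entries of the spatial diagonal block. [folklore] -/
theorem sliceDiag_apply (U : GaugeConfig 4 (n + 1) G) (m : ℝ) (t : Fin (n + 1))
    (y y' : Fin 3 → ZMod (n + 1)) (a b : Fin N) (h h' : Fin 2) :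
    sliceDiag ρ U m t ((y, a), h) ((y', b), h') =
      (if y = y' ∧ a = b ∧ h = h' then ((m + 4 : ℝ) : ℂ) else 0) -
        (1 / 2 : ℂ) * ∑ j : Fin 3, ((if y' = y + Pi.single j 1 then ρ (U (sliceSite t y, j.succ)) a b else 0) +
          (if y = y' + Pi.single j 1 then ρ (U (sliceSite t y', j.succ))⁻¹ a b else 0)) *
            (if h = h' then 1 else 0) := by
  simp only [sliceDiag, Matrix.sub_apply, Matrix.smul_apply, Matrix.one_apply, Prod.mk.injEq, smul_eq_mul,
    mul_ite, mul_one, mul_zero, Matrix.sum_apply, kron_one_two_apply, Matrix.add_apply, sliceHop, sliceHop',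
    Matrix.of_apply, and_assoc]

/-- Entries of the spatial off-diagonal block. [folklore] -/
theorem sliceOff_apply (U : GaugeConfig 4 (n + 1) G) (t : Fin (n + 1))
    (y y' : Fin 3 → ZMod (n + 1)) (a b : Fin N) (h h' : Fin 2) :
    sliceOff ρ U t ((y, a), h) ((y', b), h') =
      (1 / 2 : ℂ) * ∑ j : Fin 3, ((if y' = y + Pi.single j 1 then ρ (U (sliceSite t y, j.succ)) a b else 0) -
          (if y = y' + Pi.single j 1 then ρ (U (sliceSite t y', j.succ))⁻¹ a b else 0)) * diracBlock j h h' := by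
  simp only [sliceOff, Matrix.smul_apply, smul_eq_mul, Matrix.sum_apply, Matrix.kroneckerMap_apply,
    Matrix.sub_apply, sliceHop, sliceHop', Matrix.of_apply]

/-- Entries of the temporal block. [folklore] -/
theorem sliceLink_apply (U : GaugeConfig 4 (n + 1) G) (t : Fin (n + 1))
    (y y' : Fin 3 → ZMod (n + 1)) (a b : Fin N) (h h' : Fin 2) :
    sliceLink ρ U t ((y, a), h) ((y', b), h') =
      (if y = y' then ρ (U (sliceSite t y, 0)) a b else 0) * (if h = h' then 1 else 0) := by
  simp only [sliceLink, kron_one_two_apply, timeLink, Matrix.of_apply]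

/-- Entries of the adjoint temporal block, for a unitary representation. [folklore] -/
theorem sliceLink_conjTranspose_apply (hρ : ∀ g, ρ g ∈ Matrix.unitaryGroup (Fin N) ℂ)
    (U : GaugeConfig 4 (n + 1) G) (t : Fin (n + 1))
    (y y' : Fin 3 → ZMod (n + 1)) (a b : Fin N) (h h' : Fin 2) :
    (sliceLink ρ U t)ᴴ ((y, a), h) ((y', b), h') =
      (if y = y' then ρ (U (sliceSite t y', 0))⁻¹ a b else 0) * (if h = h' then 1 else 0) := by
  rw [Matrix.conjTranspose_apply, sliceLink_apply, star_mul']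
  by_cases hy : y = y'
  · subst hy
    by_cases hh : h = h'
    · subst hh; simp [unitaryRep_star_apply ρ hρ]
    · simp [hh, Ne.symm hh]
  · simp [hy, Ne.symm hy]

end TimeSlices

end Literature.MathematicalPhysics.QuantumLattice

end
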